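import Mathlib
import Literature.NumberTheory.LFunctions.Zhang2022.TypedSection12C
import HarnessLib

/-!
# Zhang (2022) §12, p. 71–72: the tangent lines of `𝔣𝔣_{j6}`, `𝔣𝔣_{j7}` and the four `β`-limits — the nodes `Z22:§12.u037`, `u038`, `u040`, `u042` DISCHARGED

Topic `Literature/NumberTheory/LFunctions/Zhang2022` (Landau–Siegel adjudication tree;
verdict-neutral). Y. Zhang, *Discrete mean estimates and the Landau–Siegel zero*,
arXiv:2211.02515v1 (2022) [Zhang2022LandauSiegel] — **an unrefereed manuscript under adjudication**
— §12 "Evaluation of `Ξ₁₅`", pp. 71–72 (tex L3628–L3648), the four elementary remarks used to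
linearise the integrands of (12.13)–(12.14):

> "For `0 ≤ z ≤ 0.002`, a good approximation to `𝔣𝔣_{j6}(z)` is `1 + πi(3−j)z ≃ 1 + (2β₆ − β_j)(log P)z`."
> (`Z22:§12.u037`) · "Since `4β₆ − β₁ − β₂ − β₃ ≃ 0`" (`u038`) · "For `0 ≤ z ≤ 0.004`, a good
> approximation to `𝔣𝔣_{j7}(z)` is `1 + πi(5−j)z ≃ 1 + (2β₇ − β_j)(log P)z`" (`u040`) · "Since
> `(2β₆ + 2β₇ − β₁ − β₂ − β₃)log P ≃ 2πi`" (`u042`).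

They are typed in `TypedSection12C.lean` (namespace `…Zhang2022.Typed.Sec12C`) as the CLAIM nodes
`Step12u037 c′`, `Step12u038 c′`, `Step12u040 c′`, `Step12u042 c′`: the tangent line of
`𝔣𝔣_{jμ}` at `0` (value `1`, derivative `πi(3−j)` resp. `πi(5−j)`) and the limits
`(2β₆ − β_j)log P → πi(3−j)`, `(4β₆ − Σβ_j)log P → 0`, `(2β₇ − β_j)log P → πi(5−j)`,
`(2β₆ + 2β₇ − Σβ_j)log P → 2πi` as `D → ∞`. This file PROVES all four, for every value of the
manuscript's constant `c′` of (2.13):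

* `hasDerivAt_ffF_zero`, `ffF_zero` — for the tree's generic closed form
  `ffF a k z = (1 + aπiz)e^{kπiz}` of (8.13)–(8.18) (`Section8Defs`): `ffF a k 0 = 1` and
  `(ffF a k)′(0) = (a + k)πi`; with `(a,k) = (½,3⁄2), (−½,3⁄2), (−3⁄2,3⁄2)` this is `2πi, πi, 0 = πi(3−j)`
  and with `(3⁄2,5⁄2), (½,5⁄2), (−½,5⁄2)` it is `4πi, 3πi, 2πi = πi(5−j)`;
* the `β`-arithmetic: by (2.10) `α log P = π` and by (2.13), (2.22)
  `β₁ = iα(1 − 5c′α𝓛)`, `β₂ = 2iα(1 + c′α𝓛)`, `β₃ = 3iα(1 − c′α𝓛)`, `β₆ = 3iα/2`, `β₇ = 5iα/2`, so each of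
  the four differences is EXACTLY a rational multiple of `c′πi·α𝓛` (`5, −2, 3` resp. `6`), and
  `α𝓛 = π𝓛⁻⁸ → 0` (`alpha_mul_ell_eventually_le`);
* `step12u037_holds`, `step12u038_holds`, `step12u040_holds`, `step12u042_holds`.

No new definitions, no named facts; nothing here bears on Theorems 1–2 of the source or on
Landau–Siegel zeros (these are the linearisations feeding the NUMERICAL nodes `u039`/`u043`,
which are not touched here).

## References

* Y. Zhang, arXiv:2211.02515v1 (2022), §12 pp. 71–72; (2.10), (2.13) p. 5; (2.22) p. 9;
  (8.13)–(8.18) p. 48. [cite: Zhang2022LandauSiegel, §12 pp.71–72]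
-/

noncomputable section

open Complex Real

namespace Literature.NumberTheory.LFunctions.Zhang2022.Typed.Sec12C

open Literature.NumberTheory.LFunctions.Zhang2022.Skeleton

/-! ## The tangent line of `𝔣𝔣_{jμ}` at `0` -/

/-- `𝔣𝔣(0) = 1` for the generic closed form `ffF a k z = (1 + aπiz)e^{kπiz}` of (8.13)–(8.18).
[cite: Zhang2022LandauSiegel, §8 (8.13)–(8.18) p.48] -/
theorem ffF_zero (a k : ℚ) : ffF a k 0 = 1 := by
  simp [ffF]

/-- `𝔣𝔣′(0) = (a + k)πi` for `ffF a k z = (1 + aπiz)e^{kπiz}` (product rule at `z = 0`).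
[cite: Zhang2022LandauSiegel, §8 (8.13)–(8.18) p.48] -/
theorem hasDerivAt_ffF_zero (a k : ℚ) : HasDerivAt (ffF a k) (((a : ℂ) + k) * π * I) 0 := by
  have hz : HasDerivAt (fun z : ℝ => (z : ℂ)) 1 0 := by
    simpa using (hasDerivAt_id (0 : ℝ)).ofReal_comp
  have h1 : HasDerivAt (fun z : ℝ => (1 : ℂ) + (a : ℂ) * π * I * (z : ℂ)) ((a : ℂ) * π * I) 0 := by
    have := (hz.const_mul ((a : ℂ) * π * I)).const_add 1
    simpa using this
  have h2 : HasDerivAt (fun z : ℝ => cexp ((k : ℂ) * π * I * (z : ℂ))) ((k : ℂ) * π * I) 0 := by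
    have hlin : HasDerivAt (fun z : ℝ => (k : ℂ) * π * I * (z : ℂ)) ((k : ℂ) * π * I) 0 := by
      simpa using hz.const_mul ((k : ℂ) * π * I)
    have := hlin.cexp
    simpa using this
  have h : HasDerivAt (fun z : ℝ => ((1 : ℂ) + (a : ℂ) * π * I * (z : ℂ)) * cexp ((k : ℂ) * π * I * (z : ℂ)))
      ((a : ℂ) * π * I * cexp ((k : ℂ) * π * I * ((0 : ℝ) : ℂ)) +
        ((1 : ℂ) + (a : ℂ) * π * I * ((0 : ℝ) : ℂ)) * ((k : ℂ) * π * I)) 0 := h1.mul h2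
  have hfun : (fun z : ℝ => ((1 : ℂ) + (a : ℂ) * π * I * (z : ℂ)) * cexp ((k : ℂ) * π * I * (z : ℂ))) =
      ffF a k := by
    funext z
    simp [ffF]
  rw [hfun] at h
  convert h using 1
  simp only [Complex.ofReal_zero, mul_zero, Complex.exp_zero, mul_one, add_zero]
  ring

/-- **`Z22:§12.u037` (i) / `Z22:§12.u040` (i), the six tangent lines**: `𝔣𝔣_{j6}(0) = 𝔣𝔣_{j7}(0) = 1`,
`𝔣𝔣′_{j6}(0) = πi(3−j)`, `𝔣𝔣′_{j7}(0) = πi(5−j)` for `j = 1,2,3` ((8.13)–(8.18)).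
[cite: Zhang2022LandauSiegel, §12 pp.71–72] -/
theorem ffj_tangent :
    (∀ j ∈ ({1, 2, 3} : Finset ℕ), ffj j 6 0 = 1 ∧ HasDerivAt (ffj j 6) (π * I * (3 - j)) 0) ∧
    (∀ j ∈ ({1, 2, 3} : Finset ℕ), ffj j 7 0 = 1 ∧ HasDerivAt (ffj j 7) (π * I * (5 - j)) 0) := by
  refine ⟨fun j hj => ?_, fun j hj => ?_⟩
  · simp only [Finset.mem_insert, Finset.mem_singleton] at hj
    rcases hj with rfl | rfl | rfl
    · rw [show ffj 1 6 = ffF (1/2) (3/2) from rfl]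
      refine ⟨ffF_zero (1/2) (3/2), ?_⟩
      convert hasDerivAt_ffF_zero (1/2) (3/2) using 1
      push_cast; ring
    · rw [show ffj 2 6 = ffF (-1/2) (3/2) from rfl]
      refine ⟨ffF_zero (-1/2) (3/2), ?_⟩
      convert hasDerivAt_ffF_zero (-1/2) (3/2) using 1
      push_cast; ring
    · rw [show ffj 3 6 = ffF (-3/2) (3/2) from rfl]
      refine ⟨ffF_zero (-3/2) (3/2), ?_⟩
      convert hasDerivAt_ffF_zero (-3/2) (3/2) using 1
      push_cast; ring
  · simp only [Finset.mem_insert, Finset.mem_singleton] at hj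
    rcases hj with rfl | rfl | rfl
    · rw [show ffj 1 7 = ffF (3/2) (5/2) from rfl]
      refine ⟨ffF_zero (3/2) (5/2), ?_⟩
      convert hasDerivAt_ffF_zero (3/2) (5/2) using 1
      push_cast; ring
    · rw [show ffj 2 7 = ffF (1/2) (5/2) from rfl]
      refine ⟨ffF_zero (1/2) (5/2), ?_⟩
      convert hasDerivAt_ffF_zero (1/2) (5/2) using 1
      push_cast; ring
    · rw [show ffj 3 7 = ffF (-1/2) (5/2) from rfl]
      refine ⟨ffF_zero (-1/2) (5/2), ?_⟩
      convert hasDerivAt_ffF_zero (-1/2) (5/2) using 1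
      push_cast; ring

/-! ## The `β`-arithmetic: every difference is a multiple of `c′πi·α𝓛`, and `α𝓛 → 0` -/

/-- `𝓛 > 0` for `D ≥ 2`. [cite: Zhang2022LandauSiegel, §2 (2.1)] -/
private theorem ell_pos {D : ℕ} (hD : 2 ≤ D) : 0 < ell D :=
  Real.log_pos (by exact_mod_cast hD)

/-- **`α𝓛 → 0`**: `α𝓛 = π𝓛/log P = π𝓛⁻⁸` ((2.10), (2.6)), so for every `K` and `ε > 0`,
`|K|·α𝓛 ≤ ε` for all large `D`. [cite: Zhang2022LandauSiegel, §2 (2.10)] -/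
theorem alpha_mul_ell_eventually_le (K ε : ℝ) (hε : 0 < ε) :
    ∃ D₀ : ℕ, ∀ D : ℕ, D₀ ≤ D → 2 ≤ D ∧ |K| * (alpha D * ell D) ≤ ε := by
  -- `D ≥ D₀ := ⌈exp(|K|π/ε + 1)⌉ + 2` gives `𝓛 ≥ |K|π/ε + 1`, and `α𝓛 = π/𝓛⁸ ≤ π/𝓛`
  refine ⟨⌈Real.exp (|K| * π / ε + 1)⌉₊ + 2, fun D hD => ?_⟩
  have hD2 : 2 ≤ D := le_trans (by omega) hD
  refine ⟨hD2, ?_⟩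
  have hℓ0 : 0 < ell D := ell_pos hD2
  have hM : |K| * π / ε + 1 ≤ ell D := by
    have h1 : Real.exp (|K| * π / ε + 1) ≤ D := by
      have : (⌈Real.exp (|K| * π / ε + 1)⌉₊ : ℝ) + 2 ≤ D := by exact_mod_cast hD
      linarith [Nat.le_ceil (Real.exp (|K| * π / ε + 1))]
    rw [ell, Real.le_log_iff_exp_le (by positivity)]
    exact h1
  have hℓ1 : 1 ≤ ell D := by
    have : 0 ≤ |K| * π / ε := by positivity
    linarith
  have hαℓ : alpha D * ell D = π / ell D ^ 8 := by
    rw [alpha, bigP, Real.log_exp]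
    field_simp
  rw [hαℓ]
  have h8 : ell D ≤ ell D ^ 8 := by
    calc ell D = ell D ^ 1 := (pow_one _).symm
      _ ≤ ell D ^ 8 := pow_le_pow_right₀ hℓ1 (by norm_num)
  calc |K| * (π / ell D ^ 8) ≤ |K| * (π / ell D) := by
        gcongr
    _ ≤ ε := by
        rw [← mul_div_assoc, div_le_iff₀ hℓ0]
        have h1 := mul_le_mul_of_nonneg_left hM hε.le
        have e : ε * (|K| * π / ε + 1) = |K| * π + ε := by field_simp
        rw [e] at h1
        linarith

/-- `‖r·i‖ = |r|` for real `r`. [cite: Zhang2022LandauSiegel, §2 (2.13)] -/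
private theorem norm_real_mul_I (r : ℝ) : ‖(r : ℂ) * I‖ = |r| := by
  rw [norm_mul, Complex.norm_I, mul_one, Complex.norm_real, Real.norm_eq_abs]

section BetaArithmetic

variable (c' : ℝ) {D : ℕ}

/-- `(2β₆ − β₁)log P − 2πi = 5c′π·α𝓛·i`. [cite: Zhang2022LandauSiegel, §12 p.71] -/
private theorem diff37_1 (hD : 2 ≤ D) :
    (2 * beta6 D - betaJ c' D 1) * Real.log (bigP D) - π * I * (3 - (1 : ℕ)) =
      ((5 * c' * π * (alpha D * ell D) : ℝ) : ℂ) * I := by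
  have hL : (Real.log (bigP D) : ℂ) ≠ 0 := by
    rw [bigP, Real.log_exp]; exact_mod_cast pow_ne_zero _ (ell_pos hD).ne'
  simp only [beta6, betaJ, beta1, alpha, Nat.one_mod, if_true]
  push_cast
  field_simp
  ring

/-- `(2β₆ − β₂)log P − πi = −2c′π·α𝓛·i`. [cite: Zhang2022LandauSiegel, §12 p.71] -/
private theorem diff37_2 (hD : 2 ≤ D) :
    (2 * beta6 D - betaJ c' D 2) * Real.log (bigP D) - π * I * (3 - (2 : ℕ)) =
      ((-2 * c' * π * (alpha D * ell D) : ℝ) : ℂ) * I := by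
  have hL : (Real.log (bigP D) : ℂ) ≠ 0 := by
    rw [bigP, Real.log_exp]; exact_mod_cast pow_ne_zero _ (ell_pos hD).ne'
  simp only [beta6, betaJ, beta2, alpha, show (2 : ℕ) % 3 = 2 from rfl, if_true,
    show ¬ ((2 : ℕ) = 1) from by norm_num, if_false]
  push_cast
  field_simp
  ring

/-- `(2β₆ − β₃)log P = 3c′π·α𝓛·i`. [cite: Zhang2022LandauSiegel, §12 p.71] -/
private theorem diff37_3 (hD : 2 ≤ D) :
    (2 * beta6 D - betaJ c' D 3) * Real.log (bigP D) - π * I * (3 - (3 : ℕ)) =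
      ((3 * c' * π * (alpha D * ell D) : ℝ) : ℂ) * I := by
  have hL : (Real.log (bigP D) : ℂ) ≠ 0 := by
    rw [bigP, Real.log_exp]; exact_mod_cast pow_ne_zero _ (ell_pos hD).ne'
  simp only [beta6, betaJ, beta3, alpha, show (3 : ℕ) % 3 = 0 from rfl,
    show ¬ ((0 : ℕ) = 1) from by norm_num, show ¬ ((0 : ℕ) = 2) from by norm_num, if_false]
  push_cast
  field_simp
  ring

/-- `(4β₆ − β₁ − β₂ − β₃)log P = 6c′π·α𝓛·i`. [cite: Zhang2022LandauSiegel, §12 p.72] -/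
private theorem diff38 (hD : 2 ≤ D) :
    (4 * beta6 D - beta1 c' D - beta2 c' D - beta3 c' D) * Real.log (bigP D) =
      ((6 * c' * π * (alpha D * ell D) : ℝ) : ℂ) * I := by
  have hL : (Real.log (bigP D) : ℂ) ≠ 0 := by
    rw [bigP, Real.log_exp]; exact_mod_cast pow_ne_zero _ (ell_pos hD).ne'
  simp only [beta6, beta1, beta2, beta3, alpha]
  push_cast
  field_simp
  ring

/-- `(2β₇ − β₁)log P − 4πi = 5c′π·α𝓛·i`. [cite: Zhang2022LandauSiegel, §12 p.72] -/
private theorem diff40_1 (hD : 2 ≤ D) :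
    (2 * beta7 D - betaJ c' D 1) * Real.log (bigP D) - π * I * (5 - (1 : ℕ)) =
      ((5 * c' * π * (alpha D * ell D) : ℝ) : ℂ) * I := by
  have hL : (Real.log (bigP D) : ℂ) ≠ 0 := by
    rw [bigP, Real.log_exp]; exact_mod_cast pow_ne_zero _ (ell_pos hD).ne'
  simp only [beta7, betaJ, beta1, alpha, Nat.one_mod, if_true]
  push_cast
  field_simp
  ring

/-- `(2β₇ − β₂)log P − 3πi = −2c′π·α𝓛·i`. [cite: Zhang2022LandauSiegel, §12 p.72] -/
private theorem diff40_2 (hD : 2 ≤ D) :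
    (2 * beta7 D - betaJ c' D 2) * Real.log (bigP D) - π * I * (5 - (2 : ℕ)) =
      ((-2 * c' * π * (alpha D * ell D) : ℝ) : ℂ) * I := by
  have hL : (Real.log (bigP D) : ℂ) ≠ 0 := by
    rw [bigP, Real.log_exp]; exact_mod_cast pow_ne_zero _ (ell_pos hD).ne'
  simp only [beta7, betaJ, beta2, alpha, show (2 : ℕ) % 3 = 2 from rfl, if_true,
    show ¬ ((2 : ℕ) = 1) from by norm_num, if_false]
  push_cast
  field_simp
  ring

/-- `(2β₇ − β₃)log P − 2πi = 3c′π·α𝓛·i`. [cite: Zhang2022LandauSiegel, §12 p.72] -/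
private theorem diff40_3 (hD : 2 ≤ D) :
    (2 * beta7 D - betaJ c' D 3) * Real.log (bigP D) - π * I * (5 - (3 : ℕ)) =
      ((3 * c' * π * (alpha D * ell D) : ℝ) : ℂ) * I := by
  have hL : (Real.log (bigP D) : ℂ) ≠ 0 := by
    rw [bigP, Real.log_exp]; exact_mod_cast pow_ne_zero _ (ell_pos hD).ne'
  simp only [beta7, betaJ, beta3, alpha, show (3 : ℕ) % 3 = 0 from rfl,
    show ¬ ((0 : ℕ) = 1) from by norm_num, show ¬ ((0 : ℕ) = 2) from by norm_num, if_false]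
  push_cast
  field_simp
  ring

/-- `(2β₆ + 2β₇ − β₁ − β₂ − β₃)log P − 2πi = 6c′π·α𝓛·i`. [cite: Zhang2022LandauSiegel, §12 p.72] -/
private theorem diff42 (hD : 2 ≤ D) :
    (2 * beta6 D + 2 * beta7 D - beta1 c' D - beta2 c' D - beta3 c' D) * Real.log (bigP D) -
        2 * π * I =
      ((6 * c' * π * (alpha D * ell D) : ℝ) : ℂ) * I := by
  have hL : (Real.log (bigP D) : ℂ) ≠ 0 := by
    rw [bigP, Real.log_exp]; exact_mod_cast pow_ne_zero _ (ell_pos hD).ne'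
  simp only [beta6, beta7, beta1, beta2, beta3, alpha]
  push_cast
  field_simp
  ring

/-- The common size bound: `|k·c′π·α𝓛| ≤ |6πc′|·α𝓛` for `|k| ≤ 6`. [cite: Zhang2022LandauSiegel, §12 p.72] -/
private theorem abs_mul_le_six {k : ℝ} (hk : |k| ≤ 6) (hαℓ : 0 ≤ alpha D * ell D) :
    |k * c' * π * (alpha D * ell D)| ≤ |6 * π * c'| * (alpha D * ell D) := by
  rw [abs_mul, abs_of_nonneg hαℓ, abs_mul, abs_mul, abs_of_pos Real.pi_pos,
    abs_mul, abs_mul, abs_of_pos Real.pi_pos, show |(6 : ℝ)| = 6 by norm_num]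
  have hc : 0 ≤ |c'| := abs_nonneg _
  have := mul_le_mul_of_nonneg_right hk (mul_nonneg (mul_nonneg hc Real.pi_pos.le) hαℓ)
  nlinarith [this]

end BetaArithmetic

/-- `α𝓛 ≥ 0` (both factors are nonnegative for every `D`). [cite: Zhang2022LandauSiegel, §2 (2.10)] -/
private theorem alpha_mul_ell_nonneg (D : ℕ) : 0 ≤ alpha D * ell D := by
  have hℓ : 0 ≤ ell D := Real.log_natCast_nonneg D
  have hα : 0 ≤ alpha D := by
    rw [alpha, bigP, Real.log_exp]; positivity
  exact mul_nonneg hα hℓ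

/-! ## The four nodes -/

/-- **`Z22:§12.u037` HOLDS** (p. 71, tex L3628): the tangent line of `𝔣𝔣_{j6}` at `0` is `1 + πi(3−j)z`,
and `(2β₆ − β_j)log P → πi(3−j)` (the difference is `(5, −2, 3)_j·c′π·α𝓛·i` and `α𝓛 = π𝓛⁻⁸ → 0`).
[cite: Zhang2022LandauSiegel, §12 (12.13) p.71] -/
theorem step12u037_holds (c' : ℝ) : Step12u037 c' := by
  refine ⟨ffj_tangent.1, fun ε hε => ?_⟩
  obtain ⟨D₀, hD₀⟩ := alpha_mul_ell_eventually_le (6 * π * c') ε hε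
  refine ⟨D₀, fun D _ χ hD _ _ => ?_⟩
  dsimp only
  obtain ⟨hD2, hle⟩ := hD₀ D hD
  have h0 := alpha_mul_ell_nonneg D
  intro j hj
  simp only [Finset.mem_insert, Finset.mem_singleton] at hj
  rcases hj with rfl | rfl | rfl
  · rw [diff37_1 c' hD2, norm_real_mul_I]
    exact (abs_mul_le_six c' (by norm_num) h0).trans hle
  · rw [diff37_2 c' hD2, norm_real_mul_I]
    exact (abs_mul_le_six c' (by norm_num) h0).trans hle
  · rw [diff37_3 c' hD2, norm_real_mul_I]
    exact (abs_mul_le_six c' (by norm_num) h0).trans hle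

variable (c' : ℝ) in
/-- `Step12u037` — `_holds` alias of `step12u037_holds` above under the fact's exact name, stated under the
prover's own binders as section variables (appended 2026-08-28, D-0026 bookkeeping: the proof term is the
existing theorem of this file; no statement, definition or attribute is edited; no new named fact; the
ledger's debt table listed the fact unproved). [cite: Zhang2022LandauSiegel, §12 (12.13) p.71] -/
theorem _root_.Literature.NumberTheory.LFunctions.Zhang2022.Typed.Sec12C.Step12u037_holds :
    _root_.Literature.NumberTheory.LFunctions.Zhang2022.Typed.Sec12C.Step12u037 c' :=
  _root_.Literature.NumberTheory.LFunctions.Zhang2022.Typed.Sec12C.step12u037_holds (c' := c')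

/-- **`Z22:§12.u038` HOLDS** (p. 72, tex L3632): `(4β₆ − β₁ − β₂ − β₃)log P = 6c′π·α𝓛·i → 0`.
[cite: Zhang2022LandauSiegel, §12 (12.14) p.72] -/
theorem step12u038_holds (c' : ℝ) : Step12u038 c' := by
  intro ε hε
  obtain ⟨D₀, hD₀⟩ := alpha_mul_ell_eventually_le (6 * π * c') ε hε
  refine ⟨D₀, fun D _ χ hD _ _ => ?_⟩
  dsimp only
  obtain ⟨hD2, hle⟩ := hD₀ D hD
  rw [diff38 c' hD2, norm_real_mul_I]
  exact (abs_mul_le_six c' (by norm_num) (alpha_mul_ell_nonneg D)).trans hle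

variable (c' : ℝ) in
/-- `Step12u038` — `_holds` alias of `step12u038_holds` above under the fact's exact name, stated under the
prover's own binders as section variables (appended 2026-08-28, D-0026 bookkeeping: the proof term is the
existing theorem of this file; no statement, definition or attribute is edited; no new named fact; the
ledger's debt table listed the fact unproved). [cite: Zhang2022LandauSiegel, §12 (12.14) p.72] -/
theorem _root_.Literature.NumberTheory.LFunctions.Zhang2022.Typed.Sec12C.Step12u038_holds :
    _root_.Literature.NumberTheory.LFunctions.Zhang2022.Typed.Sec12C.Step12u038 c' :=
  _root_.Literature.NumberTheory.LFunctions.Zhang2022.Typed.Sec12C.step12u038_holds (c' := c')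

/-- **`Z22:§12.u040` HOLDS** (p. 72, tex L3640): the tangent line of `𝔣𝔣_{j7}` at `0` is `1 + πi(5−j)z`,
and `(2β₇ − β_j)log P → πi(5−j)`. [cite: Zhang2022LandauSiegel, §12 (12.14) p.72] -/
theorem step12u040_holds (c' : ℝ) : Step12u040 c' := by
  refine ⟨ffj_tangent.2, fun ε hε => ?_⟩
  obtain ⟨D₀, hD₀⟩ := alpha_mul_ell_eventually_le (6 * π * c') ε hε
  refine ⟨D₀, fun D _ χ hD _ _ => ?_⟩
  dsimp only
  obtain ⟨hD2, hle⟩ := hD₀ D hD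
  have h0 := alpha_mul_ell_nonneg D
  intro j hj
  simp only [Finset.mem_insert, Finset.mem_singleton] at hj
  rcases hj with rfl | rfl | rfl
  · rw [diff40_1 c' hD2, norm_real_mul_I]
    exact (abs_mul_le_six c' (by norm_num) h0).trans hle
  · rw [diff40_2 c' hD2, norm_real_mul_I]
    exact (abs_mul_le_six c' (by norm_num) h0).trans hle
  · rw [diff40_3 c' hD2, norm_real_mul_I]
    exact (abs_mul_le_six c' (by norm_num) h0).trans hle

variable (c' : ℝ) in
/-- `Step12u040` — `_holds` alias of `step12u040_holds` above under the fact's exact name, stated under the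
prover's own binders as section variables (appended 2026-08-28, D-0026 bookkeeping: the proof term is the
existing theorem of this file; no statement, definition or attribute is edited; no new named fact; the
ledger's debt table listed the fact unproved). [cite: Zhang2022LandauSiegel, §12 (12.14) p.72] -/
theorem _root_.Literature.NumberTheory.LFunctions.Zhang2022.Typed.Sec12C.Step12u040_holds :
    _root_.Literature.NumberTheory.LFunctions.Zhang2022.Typed.Sec12C.Step12u040 c' :=
  _root_.Literature.NumberTheory.LFunctions.Zhang2022.Typed.Sec12C.step12u040_holds (c' := c')

/-- **`Z22:§12.u042` HOLDS** (p. 72, tex L3648): `(2β₆ + 2β₇ − β₁ − β₂ − β₃)log P − 2πi = 6c′π·α𝓛·i → 0`.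
[cite: Zhang2022LandauSiegel, §12 (12.14) p.72] -/
theorem step12u042_holds (c' : ℝ) : Step12u042 c' := by
  intro ε hε
  obtain ⟨D₀, hD₀⟩ := alpha_mul_ell_eventually_le (6 * π * c') ε hε
  refine ⟨D₀, fun D _ χ hD _ _ => ?_⟩
  dsimp only
  obtain ⟨hD2, hle⟩ := hD₀ D hD
  rw [diff42 c' hD2, norm_real_mul_I]
  exact (abs_mul_le_six c' (by norm_num) (alpha_mul_ell_nonneg D)).trans hle

variable (c' : ℝ) in
/-- `Step12u042` — `_holds` alias of `step12u042_holds` above under the fact's exact name, stated under the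
prover's own binders as section variables (appended 2026-08-28, D-0026 bookkeeping: the proof term is the
existing theorem of this file; no statement, definition or attribute is edited; no new named fact; the
ledger's debt table listed the fact unproved). [cite: Zhang2022LandauSiegel, §12 (12.14) p.72] -/
theorem _root_.Literature.NumberTheory.LFunctions.Zhang2022.Typed.Sec12C.Step12u042_holds :
    _root_.Literature.NumberTheory.LFunctions.Zhang2022.Typed.Sec12C.Step12u042 c' :=
  _root_.Literature.NumberTheory.LFunctions.Zhang2022.Typed.Sec12C.step12u042_holds (c' := c')

end Literature.NumberTheory.LFunctions.Zhang2022.Typed.Sec12C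

end
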